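import Literature.Probability.RandomPlanarGeometry.SAWIrreducibleBridgeCrossings
import HarnessLib

/-!
# An irreducible bridge of span `A ≥ 2` has at least `3A` steps (Madras–Slade, §4.2, p. 94)

Topic `Literature/Probability/RandomPlanarGeometry` (continues `SAWIrreducibleBridgeCrossings.lean`, which proves the weaker
`three_mul_span_le : 3 · span ≤ k + 2` for EVERY irreducible `k`-step bridge, all spans `A ≥ 1`).

Source: N. Madras, G. Slade, *The Self-Avoiding Walk* (1993; 2013 reprint pagination), §4.2, p. 94, the remark after Theorem 4.2.4
(held scan `book:madras1993-self-avoiding-walk` p0109:L47–50): "an irreducible bridge of span `L ≥ 2` must have at least `3L` steps"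
— stated there without proof; it is what makes `A_z(L) ≤ Σ_{N ≥ 3L} b_N z^N` in (4.2.21)–(4.2.22). PROVED HERE as printed.

## The argument

As in `three_mul_span_le`: heights `h(t) = ω₁(t)` change by at most one per step; the gap `{0,1}` is crossed at time `0` and every
internal gap `{g, g+1}` (`1 ≤ g ≤ A − 1`) at least three times (else the first up-crossing time would be a renewal time), at pairwise
distinct times — `3A − 2` VERTICAL steps. Self-avoidance adds two HORIZONTAL steps when `A ≥ 2`: there is then a down-step; the step
just before the FIRST down-step is neither down (minimality) nor up (`+e₁` followed by `−e₁` revisits a site), and the step just after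
the LAST down-step is neither down nor up (`−e₁, +e₁` revisits; the last step of a bridge is not down) — two distinct transverse times,
which are not crossing times. Hence `k ≥ 3A`.

## Contents (namespace `Literature.Probability.RandomPlanarGeometry.SAW.Zd`; theorems only, no data, no new definitions)
private helpers (discrete intermediate-value steps, copies of the private ones of `SAWIrreducibleBridgeCrossings`; the unit steps `±e₁`
and the two revisit lemmas), ★ **`three_mul_span_le_of_two_le`** (`2 ≤ span → 3 · span ≤ k`, `ℕ` form with `Int.toNat`),
`three_mul_span_le_int_of_two_le` (`ℤ` form), and the length form ★ `irreducibleBridges_span_cases`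
(`span = 1 ∨ 3 · span ≤ k`). Every dimension `d ≥ 1`. Lane «pcv-sawmu» (a-p3 g16, 2026-08-24); consumed by the cost-four
census of the pulled-walk expansion (`N_{c,n} = 0` unless `2n ≤ 3c` or `n = c + 1`).

## Sequels

`SAWIrreducibleBridgeThreeSpanExtremal.lean` treats the EQUALITY CASE `k = 3A`: the counting below is then tight (every time other than the
two transverse times is a crossing time), the three vertical runs are monotone, and irreducibility places the first transverse step at the top
height — the height profile is forced to the staple `U^A T D^{A−1} T U^{A−1}` (`heights_of_length_eq_three_mul_span`);
`SAWPulledLargeForceExpansionZdStaples.lean` counts the staples of `ℤ^{d+1}`: `N_{2A,3A} = 2d(2d−1)` for every `A ≥ 2`. In the cost grading of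
the pulled-walk expansion (`SAWPulledLargeForceExpansionZdFourthOrder.costCoeffZd_eq_zero_of_three_span`) the present lemma reads
`N_{c,n} = 0` unless `n = c + 1` or `2n ≤ 3c`.
-/

noncomputable section

open Finset Literature.Probability.LatticeModels SimpleGraph
open scoped BigOperators

namespace Literature.Probability.RandomPlanarGeometry.SAW.Zd

variable {d : ℕ} [NeZero d]

/-! ### Discrete intermediate-value steps (copies of the private helpers of `SAWIrreducibleBridgeCrossings`) -/

/-- First up-crossing of the gap `{g, g+1}` after `t₀`, for a `±1`-Lipschitz integer sequence. [folklore] -/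
private theorem upcross_of_lipschitz {h : ℕ → ℤ} {k : ℕ} (hstep : ∀ t, t < k → |h (t + 1) - h t| ≤ 1)
    {t₀ s₁ : ℕ} {g : ℤ} (h01 : t₀ ≤ s₁) (hs₁ : s₁ ≤ k) (hlo : h t₀ ≤ g) (hhi : g + 1 ≤ h s₁) :
    ∃ t, t₀ ≤ t ∧ t < s₁ ∧ h t = g ∧ h (t + 1) = g + 1 := by
  classical
  have hex : ∃ s, t₀ ≤ s ∧ s ≤ s₁ ∧ g + 1 ≤ h s := ⟨s₁, h01, le_rfl, hhi⟩
  obtain ⟨s, ⟨hs0, hss₁, hsg⟩, hmin⟩ : ∃ s, (t₀ ≤ s ∧ s ≤ s₁ ∧ g + 1 ≤ h s) ∧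
      ∀ u, u < s → ¬ (t₀ ≤ u ∧ u ≤ s₁ ∧ g + 1 ≤ h u) :=
    ⟨Nat.find hex, Nat.find_spec hex, fun u hu => Nat.find_min hex hu⟩
  have hst₀ : s ≠ t₀ := by
    rintro rfl
    omega
  obtain ⟨t, rfl⟩ : ∃ t, s = t + 1 := ⟨s - 1, by omega⟩
  have ht : h t ≤ g := by
    have := hmin t (Nat.lt_succ_self t)
    simp only [not_and, not_le] at this
    have := this (by omega) (by omega)
    omega
  have hs := hstep t (by omega)
  rw [abs_le] at hs
  exact ⟨t, by omega, by omega, by omega, by omega⟩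

/-- First down-crossing of the gap `{g, g+1}` after `t₀`, for a `±1`-Lipschitz integer sequence. [folklore] -/
private theorem downcross_of_lipschitz {h : ℕ → ℤ} {k : ℕ} (hstep : ∀ t, t < k → |h (t + 1) - h t| ≤ 1)
    {t₀ s₁ : ℕ} {g : ℤ} (h01 : t₀ ≤ s₁) (hs₁ : s₁ ≤ k) (hhi : g + 1 ≤ h t₀) (hlo : h s₁ ≤ g) :
    ∃ t, t₀ ≤ t ∧ t < s₁ ∧ h t = g + 1 ∧ h (t + 1) = g := by
  classical
  have hex : ∃ s, t₀ ≤ s ∧ s ≤ s₁ ∧ h s ≤ g := ⟨s₁, h01, le_rfl, hlo⟩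
  obtain ⟨s, ⟨hs0, hss₁, hsg⟩, hmin⟩ : ∃ s, (t₀ ≤ s ∧ s ≤ s₁ ∧ h s ≤ g) ∧
      ∀ u, u < s → ¬ (t₀ ≤ u ∧ u ≤ s₁ ∧ h u ≤ g) :=
    ⟨Nat.find hex, Nat.find_spec hex, fun u hu => Nat.find_min hex hu⟩
  have hst₀ : s ≠ t₀ := by
    rintro rfl
    omega
  obtain ⟨t, rfl⟩ : ∃ t, s = t + 1 := ⟨s - 1, by omega⟩
  have ht : g + 1 ≤ h t := by
    have := hmin t (Nat.lt_succ_self t)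
    simp only [not_and, not_le] at this
    have := this (by omega) (by omega)
    omega
  have hs := hstep t (by omega)
  rw [abs_le] at hs
  exact ⟨t, by omega, by omega, by omega, by omega⟩

/-! ### Vertical unit steps and the two revisit lemmas -/

/-- A lattice step that raises the first coordinate is `+e₁`. [cite: MadrasSlade1993, Definition 1.2.4] -/
private theorem eq_add_single_zero_of_adj_up {x z : Site d} (ha : (zdGraph d).Adj x z) (h0 : z 0 = x 0 + 1) :
    z = x + Pi.single 0 1 := by
  rw [zdGraph_adj_iff] at ha
  obtain ⟨i, hi | hi⟩ := ha
  · by_cases hi0 : i = 0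
    · subst hi0; exact hi
    · have hc := congrFun hi 0
      rw [Pi.add_apply, Pi.single_eq_of_ne (Ne.symm hi0)] at hc
      omega
  · have hc := congrFun hi 0
    rw [Pi.add_apply] at hc
    by_cases hi0 : i = 0
    · subst hi0; rw [Pi.single_eq_same] at hc; omega
    · rw [Pi.single_eq_of_ne (Ne.symm hi0)] at hc; omega

/-- A lattice step that lowers the first coordinate is `−e₁`. [cite: MadrasSlade1993, Definition 1.2.4] -/
private theorem eq_sub_single_zero_of_adj_down {x z : Site d} (ha : (zdGraph d).Adj x z) (h0 : z 0 = x 0 - 1) :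
    z = x - Pi.single 0 1 := by
  rw [zdGraph_adj_iff] at ha
  obtain ⟨i, hi | hi⟩ := ha
  · have hc := congrFun hi 0
    rw [Pi.add_apply] at hc
    by_cases hi0 : i = 0
    · subst hi0; rw [Pi.single_eq_same] at hc; omega
    · rw [Pi.single_eq_of_ne (Ne.symm hi0)] at hc; omega
  · by_cases hi0 : i = 0
    · subst hi0; rw [hi]; simp
    · have hc := congrFun hi 0
      rw [Pi.add_apply, Pi.single_eq_of_ne (Ne.symm hi0)] at hc
      omega

/-- `+e₁` followed by `−e₁` returns to the start. [cite: MadrasSlade1993, Definition 1.2.4] -/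
private theorem eq_of_adj_up_down {x y z : Site d} (hxy : (zdGraph d).Adj x y) (hyz : (zdGraph d).Adj y z)
    (h1 : y 0 = x 0 + 1) (h2 : z 0 = y 0 - 1) : z = x := by
  rw [eq_sub_single_zero_of_adj_down hyz h2, eq_add_single_zero_of_adj_up hxy h1, add_sub_cancel_right]

/-- `−e₁` followed by `+e₁` returns to the start. [cite: MadrasSlade1993, Definition 1.2.4] -/
private theorem eq_of_adj_down_up {x y z : Site d} (hxy : (zdGraph d).Adj x y) (hyz : (zdGraph d).Adj y z)
    (h1 : y 0 = x 0 - 1) (h2 : z 0 = y 0 + 1) : z = x := by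
  rw [eq_add_single_zero_of_adj_up hyz h2, eq_sub_single_zero_of_adj_down hxy h1, sub_add_cancel]

/-! ### The theorem -/

/-- ★ **Madras–Slade's three-span remark, as printed.** Every irreducible `k`-step bridge `ω` on `ℤ^d` whose span `A = ω₁(k)` is at
least `2` satisfies `3A ≤ k`: the `3A − 2` crossing times of `three_mul_span_le` are vertical steps, and a self-avoiding bridge of
span `≥ 2` has moreover two horizontal steps (just before its first down-step and just after its last down-step).
[cite: MadrasSlade1993, §4.2, remark after Theorem 4.2.4 (p. 94)] -/
theorem three_mul_span_le_of_two_le {k : ℕ} {ω : ℕ → Site d}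
    (hω : ω ∈ irreducibleBridges d k) (hA2 : 2 ≤ (ω k 0).toNat) : 3 * (ω k 0).toNat ≤ k := by
  classical
  obtain ⟨hb, hk1, hbr, hirr⟩ := mem_irreducibleBridges.1 hω
  obtain ⟨hωs, -⟩ := mem_bridges.1 hb
  obtain ⟨hω0, -, hadj, hinj⟩ := mem_saws.1 hωs
  -- heights
  set h : ℕ → ℤ := fun t => ω t 0 with hh
  have h0 : h 0 = 0 := by simp only [hh, hω0]; rfl
  have hstep : ∀ t, t < k → |h (t + 1) - h t| ≤ 1 := fun t ht => abs_sub_le_one_of_adj (hadj t ht) 0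
  have hpos : ∀ i, 1 ≤ i → i ≤ k → 0 < h i ∧ h i ≤ h k := fun i hi1 hi2 => by
    have := hbr i hi1 hi2
    rw [hω0] at this
    exact this
  set A : ℤ := h k with hA
  have hA2' : 2 ≤ A := by
    have : ((ω k 0).toNat : ℤ) = ω k 0 := Int.toNat_of_nonneg (by have := (hpos k hk1 le_rfl).1; omega)
    have h2 : (2 : ℤ) ≤ ((ω k 0).toNat : ℤ) := by exact_mod_cast hA2
    rw [this] at h2
    exact h2
  have h1 : h 1 = 1 := by
    have := (hpos 1 le_rfl hk1).1
    have hs := hstep 0 hk1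
    rw [zero_add, abs_le] at hs
    omega
  -- no step pair up-down or down-up (self-avoidance)
  have hmem : ∀ i : ℕ, i ≤ k → i ∈ {j : ℕ | j ≤ k} := fun i hi => hi
  have no_ud : ∀ t, t + 2 ≤ k → h (t + 1) = h t + 1 → h (t + 2) = h (t + 1) - 1 → False := by
    intro t ht hu hd'
    have he : ω (t + 2) = ω t := eq_of_adj_up_down (hadj t (by omega)) (hadj (t + 1) (by omega)) hu hd'
    have := hinj (hmem (t + 2) ht) (hmem t (by omega)) he
    omega
  have no_du : ∀ t, t + 2 ≤ k → h (t + 1) = h t - 1 → h (t + 2) = h (t + 1) + 1 → False := by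
    intro t ht hd' hu
    have he : ω (t + 2) = ω t := eq_of_adj_down_up (hadj t (by omega)) (hadj (t + 1) (by omega)) hd' hu
    have := hinj (hmem (t + 2) ht) (hmem t (by omega)) he
    omega
  -- crossing times of the gap `{g, g+1}`
  set C : ℤ → Finset ℕ := fun g => (range k).filter fun t =>
    (h t = g ∧ h (t + 1) = g + 1) ∨ (h t = g + 1 ∧ h (t + 1) = g) with hC
  have hmemC : ∀ {g : ℤ} {t : ℕ}, t ∈ C g ↔ t < k ∧ ((h t = g ∧ h (t + 1) = g + 1) ∨ (h t = g + 1 ∧ h (t + 1) = g)) := by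
    intro g t
    simp only [hC, Finset.mem_filter, Finset.mem_range]
  have hdisj : ∀ g g' : ℤ, g ≠ g' → Disjoint (C g) (C g') := by
    intro g g' hne
    rw [Finset.disjoint_left]
    intro t ht ht'
    rw [hmemC] at ht ht'
    omega
  -- gap `0` is crossed at time `0`
  have hC0 : 1 ≤ (C 0).card := by
    have : 0 ∈ C 0 := by rw [hmemC]; exact ⟨hk1, Or.inl ⟨h0, by rw [h1]; norm_num⟩⟩
    exact Finset.card_pos.2 ⟨0, this⟩
  -- an internal gap is crossed up, then down, then up again
  have hcross3 : ∀ g : ℤ, 1 ≤ g → g + 1 ≤ A →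
      ∃ t₁ td t₂ : ℕ, t₁ < td ∧ td < t₂ ∧ t₂ < k ∧ h t₁ = g ∧ h (t₁ + 1) = g + 1 ∧ h td = g + 1 ∧ h (td + 1) = g ∧
        h t₂ = g ∧ h (t₂ + 1) = g + 1 := by
    intro g hg1 hgA
    -- first up-crossing, staying `≤ g` before it: use the minimal time of height `≥ g + 1`
    have hex : ∃ s, g + 1 ≤ h s ∧ s ≤ k := ⟨k, hgA, le_rfl⟩
    obtain ⟨s₀, ⟨hs₀g, hs₀k⟩, hs₀min⟩ : ∃ s, (g + 1 ≤ h s ∧ s ≤ k) ∧ ∀ u, u < s → ¬ (g + 1 ≤ h u ∧ u ≤ k) :=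
      ⟨Nat.find hex, Nat.find_spec hex, fun u hu => Nat.find_min hex hu⟩
    have hs₀0 : s₀ ≠ 0 := by rintro rfl; rw [h0] at hs₀g; omega
    obtain ⟨t₁, rfl⟩ : ∃ t, s₀ = t + 1 := ⟨s₀ - 1, by omega⟩
    have hbelow : ∀ u, u ≤ t₁ → h u ≤ g := by
      intro u hu
      have := hs₀min u (by omega)
      simp only [not_and, not_le] at this
      by_contra hcon
      exact absurd (this (by omega)) (by omega)
    have ht₁g : h t₁ = g := by
      have hs := hstep t₁ (by omega)
      rw [abs_le] at hs
      have := hbelow t₁ le_rfl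
      omega
    have ht₁g1 : h (t₁ + 1) = g + 1 := by
      have hs := hstep t₁ (by omega)
      rw [abs_le] at hs
      omega
    have ht₁1 : 1 ≤ t₁ := by
      by_contra h00
      have : t₁ = 0 := by omega
      rw [this, h0] at ht₁g
      omega
    have ht₁k : t₁ < k := by omega
    -- the walk comes back to height `≤ g` after `t₁`, else `t₁` is a renewal time
    have hback : ∃ s, t₁ + 1 ≤ s ∧ s ≤ k ∧ h s ≤ g := by
      by_contra hno
      simp only [not_exists, not_and, not_le] at hno
      refine hirr t₁ ht₁1 (by omega) ⟨ht₁k.le, ?_, ?_⟩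
      · intro i hi1 hi2
        refine ⟨(hpos i hi1 (by omega)).1 |> fun h' => by rw [hω0]; exact h', ?_⟩
        show h i ≤ h t₁
        rw [ht₁g]; exact hbelow i hi2
      · intro j hj1 hj2
        refine ⟨?_, ?_⟩
        · show h (t₁ + 0) < h (t₁ + j)
          rw [add_zero, ht₁g]
          have := hno (t₁ + j) (by omega) (by omega)
          omega
        · show h (t₁ + j) ≤ h (t₁ + (k - t₁))
          rw [show t₁ + (k - t₁) = k by omega]
          exact (hpos (t₁ + j) (by omega) (by omega)).2
    obtain ⟨s, hs1, hsk, hsg⟩ := hback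
    obtain ⟨td, htd1, htds, htdg1, htdg⟩ :=
      downcross_of_lipschitz (g := g) (t₀ := t₁ + 1) (s₁ := s) hstep hs1 hsk (by rw [ht₁g1]) hsg
    obtain ⟨t₂, ht₂1, ht₂k, ht₂g, ht₂g1⟩ :=
      upcross_of_lipschitz (g := g) (t₀ := td + 1) (s₁ := k) hstep (show td + 1 ≤ k by omega) le_rfl (by rw [htdg]) hgA
    exact ⟨t₁, td, t₂, by omega, by omega, ht₂k, ht₁g, ht₁g1, htdg1, htdg, ht₂g, ht₂g1⟩
  have hC3 : ∀ g : ℤ, 1 ≤ g → g + 1 ≤ A → 3 ≤ (C g).card := by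
    intro g hg1 hgA
    obtain ⟨t₁, td, t₂, h12, h23, ht₂k, ht₁g, ht₁g1, htdg1, htdg, ht₂g, ht₂g1⟩ := hcross3 g hg1 hgA
    have hsub : ({t₁, td, t₂} : Finset ℕ) ⊆ C g := by
      intro t ht
      simp only [Finset.mem_insert, Finset.mem_singleton] at ht
      rw [hmemC]
      rcases ht with rfl | rfl | rfl
      · exact ⟨by omega, Or.inl ⟨ht₁g, ht₁g1⟩⟩
      · exact ⟨by omega, Or.inr ⟨htdg1, htdg⟩⟩
      · exact ⟨ht₂k, Or.inl ⟨ht₂g, ht₂g1⟩⟩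
    have hcard : ({t₁, td, t₂} : Finset ℕ).card = 3 := by
      rw [Finset.card_eq_three]
      exact ⟨t₁, td, t₂, by omega, by omega, by omega, rfl⟩
    calc 3 = ({t₁, td, t₂} : Finset ℕ).card := hcard.symm
      _ ≤ (C g).card := Finset.card_le_card hsub
  -- the down-steps; the first and the last one are flanked by transverse steps
  set D : Finset ℕ := (range k).filter fun t => h (t + 1) = h t - 1 with hD
  have hmemD : ∀ {t : ℕ}, t ∈ D ↔ t < k ∧ h (t + 1) = h t - 1 := by
    intro t; simp only [hD, Finset.mem_filter, Finset.mem_range]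
  have hDne : D.Nonempty := by
    obtain ⟨t₁, td, t₂, -, h23, ht₂k, -, -, htdg1, htdg, -, -⟩ := hcross3 1 le_rfl (by omega)
    exact ⟨td, hmemD.2 ⟨by omega, by rw [htdg, htdg1]; ring⟩⟩
  set tm := D.min' hDne with htm
  set tM := D.max' hDne with htM
  have htmD : tm ∈ D := Finset.min'_mem D hDne
  have htMD : tM ∈ D := Finset.max'_mem D hDne
  obtain ⟨htmk, htmd⟩ := hmemD.1 htmD
  obtain ⟨htMk, htMd⟩ := hmemD.1 htMD
  -- `tm ≥ 1` (step `0` is up) and the step before `tm` is transverse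
  have htm1 : 1 ≤ tm := by
    by_contra h00
    have : tm = 0 := by omega
    rw [this, zero_add, h1, h0] at htmd
    omega
  obtain ⟨τ₁, hτ₁⟩ : ∃ τ, tm = τ + 1 := ⟨tm - 1, by omega⟩
  have hτ₁flat : h (τ₁ + 1) = h τ₁ := by
    have hs := hstep τ₁ (by omega)
    rw [abs_le] at hs
    rcases lt_trichotomy (h (τ₁ + 1)) (h τ₁) with hlt | heq | hgt
    · -- step `τ₁` would be a down-step earlier than `tm`
      have hmem' : τ₁ ∈ D := hmemD.2 ⟨by omega, by omega⟩
      have := Finset.min'_le D τ₁ hmem'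
      rw [← htm] at this
      omega
    · exact heq
    · -- up then down: a revisited site
      exact (no_ud τ₁ (by omega) (by omega) (by rw [show τ₁ + 2 = tm + 1 by omega, show τ₁ + 1 = tm by omega]; exact htmd)).elim
  -- `tM ≤ k - 2` (the last step of a bridge is not down) and the step after `tM` is transverse
  have htMk2 : tM + 2 ≤ k := by
    by_contra hcon
    have : tM + 1 = k := by omega
    have hle : h tM ≤ h k := (hpos tM (by
      by_contra h00
      have h00' : tM = 0 := by omega
      rw [h00', zero_add, h1, h0] at htMd; omega) htMk.le).2
    rw [← this] at hle
    omega
  have hτ₂flat : h (tM + 1 + 1) = h (tM + 1) := by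
    have hs := hstep (tM + 1) (by omega)
    rw [abs_le] at hs
    rcases lt_trichotomy (h (tM + 1 + 1)) (h (tM + 1)) with hlt | heq | hgt
    · have hmem' : tM + 1 ∈ D := hmemD.2 ⟨by omega, by omega⟩
      have := Finset.le_max' D (tM + 1) hmem'
      rw [← htM] at this
      omega
    · exact heq
    · exact (no_du tM htMk2 htMd (by rw [show tM + 2 = tM + 1 + 1 from rfl]; omega)).elim
  -- the two transverse times
  set T : Finset ℕ := {τ₁, tM + 1} with hT
  have hτlt : τ₁ < tM + 1 := by
    have := Finset.min'_le D tM htMD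
    rw [← htm] at this
    omega
  have hTcard : T.card = 2 := by
    rw [hT, Finset.card_pair (by omega)]
  have hTsub : T ⊆ range k := by
    intro t ht
    rw [hT, Finset.mem_insert, Finset.mem_singleton] at ht
    rw [Finset.mem_range]
    rcases ht with rfl | rfl <;> omega
  have hTdisj : ∀ g : ℤ, Disjoint (C g) T := by
    intro g
    rw [Finset.disjoint_right]
    intro t ht htC
    rw [hT, Finset.mem_insert, Finset.mem_singleton] at ht
    rw [hmemC] at htC
    rcases ht with rfl | rfl
    · rw [hτ₁flat] at htC; omega
    · rw [hτ₂flat] at htC; omega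
  -- count: distinct gaps are crossed at distinct times `< k`, none of them in `T`
  obtain ⟨M, hM⟩ : ∃ M : ℕ, A.toNat = M + 1 := ⟨A.toNat - 1, by omega⟩
  set U : Finset ℕ := (range (M + 1)).biUnion fun i : ℕ => C (i : ℤ) with hU'
  have hU : U ⊆ range k := by
    intro t ht
    obtain ⟨i, -, hi⟩ := Finset.mem_biUnion.1 ht
    rw [hmemC] at hi
    exact Finset.mem_range.2 hi.1
  have hUT : Disjoint U T := by
    rw [hU', Finset.disjoint_biUnion_left]
    intro i _
    exact hTdisj _
  have hsumU : U.card = ∑ i ∈ range (M + 1), (C (i : ℤ)).card := by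
    rw [hU', Finset.card_biUnion]
    intro i _ j _ hij
    exact hdisj _ _ (by exact_mod_cast hij)
  have hsum : ∑ i ∈ range (M + 1), (C (i : ℤ)).card + 2 ≤ k := by
    have h' : (U ∪ T).card ≤ (range k).card := Finset.card_le_card (Finset.union_subset hU hTsub)
    rw [Finset.card_union_of_disjoint hUT, hsumU, hTcard, Finset.card_range] at h'
    exact h'
  have hlow : 1 + 3 * M ≤ ∑ i ∈ range (M + 1), (C (i : ℤ)).card := by
    rw [Finset.sum_range_succ']
    have h3 : 3 * M ≤ ∑ i ∈ range M, (C ((i + 1 : ℕ) : ℤ)).card := by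
      calc 3 * M = ∑ i ∈ range M, 3 := by simp [mul_comm]
        _ ≤ ∑ i ∈ range M, (C ((i + 1 : ℕ) : ℤ)).card :=
            Finset.sum_le_sum fun i hi => by
              have hi' := Finset.mem_range.1 hi
              exact hC3 _ (by push_cast; omega) (by push_cast; omega)
    have h1' : 1 ≤ (C ((0 : ℕ) : ℤ)).card := by simpa using hC0
    omega
  have hM' : (ω k 0).toNat = M + 1 := hM
  rw [hM']
  omega

/-- `ℤ` form: `3 · ω₁(k) ≤ k` for every irreducible `k`-step bridge of span `ω₁(k) ≥ 2`.
[cite: MadrasSlade1993, §4.2, remark after Theorem 4.2.4 (p. 94)] -/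
theorem three_mul_span_le_int_of_two_le {k : ℕ} {ω : ℕ → Site d}
    (hω : ω ∈ irreducibleBridges d k) (hA2 : 2 ≤ ω k 0) : 3 * ω k 0 ≤ (k : ℤ) := by
  have h0 : 0 ≤ ω k 0 := by omega
  have hc : ((ω k 0).toNat : ℤ) = ω k 0 := Int.toNat_of_nonneg h0
  have hA2' : 2 ≤ (ω k 0).toNat := by
    have : (2 : ℤ) ≤ ((ω k 0).toNat : ℤ) := by rw [hc]; exact hA2
    exact_mod_cast this
  have h := three_mul_span_le_of_two_le hω hA2'
  have h' : (3 : ℤ) * ((ω k 0).toNat : ℤ) ≤ (k : ℤ) := by exact_mod_cast h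
  rwa [hc] at h'

/-- ★ **Length versus span of an irreducible bridge**: either the span is `1`, or `3 · span ≤ k` (the span of an irreducible
`k`-step bridge, `k ≥ 1`, is at least `1`). [cite: MadrasSlade1993, §4.2, remark after Theorem 4.2.4 (p. 94)] -/
theorem irreducibleBridges_span_cases {k : ℕ} {ω : ℕ → Site d} (hω : ω ∈ irreducibleBridges d k) :
    (ω k 0).toNat = 1 ∨ 3 * (ω k 0).toNat ≤ k := by
  obtain ⟨hb, hk1, hbr, -⟩ := mem_irreducibleBridges.1 hω
  have h00 : ω 0 = 0 := (mem_saws.1 (mem_bridges.1 hb).1).1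
  have hk0 : 0 < ω k 0 := by have := (hbr k hk1 le_rfl).1; rwa [h00] at this
  rcases Nat.lt_or_ge (ω k 0).toNat 2 with hlt | hge
  · left; omega
  · right; exact three_mul_span_le_of_two_le hω hge

end Literature.Probability.RandomPlanarGeometry.SAW.Zd

end
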